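import Mathlib
import HarnessLib
import Summits.NavierStokesRegularity.NavierStokesRegularity.Theorems.PoloidalWindowDoorLrcModEntireQ4CurvedTranslationFlat
import Summits.NavierStokesRegularity.NavierStokesRegularity.Theorems.PoloidalWindowDoorLrcModEntireQ4CurvedPeriodic

/-!
# Route `PoloidalWindowDoor`, item `LrcModEntire` (stmt-NavierStokesRegularity-20428), cell (Q4-curved), VERTICAL child, uniformly-curved residue —
# LEMMA P: THE PERIODIC-TRANSLATION-LIMIT KILL (the v13 periodic mechanism re-run on the TRANSLATION HULL, vertical case)

Cell ns-regularity-ideate, stub-worker seat ns-poloidal-K2-p2 g19 under the LEAD of item 20428 (ns-poloidal-K2-p3 g18); `--supports stmt-NavierStokesRegularity-20428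
--as helper`.  Scoping line 2026-08-30T04:01:48Z (HOME STATUS.md).

After LEMMA T (`…Q4CurvedTranslationFlat`: a FLAT translation limit of the base curve is contradictory) the next translation-hull sub-case is a PERIODIC one:
some sequence of base points `Γ(a n)` along the curtain's base curve has translated curves `Γ(a n + ·) − Γ(a n)` converging pointwise to a `C²` unit-speed curve `Γ′`
with a non-zero TRANSLATION PERIOD, `Γ′(s + L) = Γ′(s) + τ⃗`, `τ⃗ ≠ 0` (e.g. asymptotically periodic curvature).  Translating the hull element `U` by `Γ(a n)` and
extracting (`…SqueezeCycleExtremalElementExistsExtraction.exists_tendsto_of_isTypeIAncientMild_seq`) gives a class profile `W′` with the hot value at the origin,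
poloidal, obeying the SAME slab law `∂₂W′_b = μ(t,x₂)∂_bW′₂` (translations are horizontal, `μ` depends on `(t, x₂)` only), whose time `−1` slice is horizontally
critical in its vertical component on the cylinder `Γ′ × ℝ` ((E1) transported along moving points) with `s`-free values there ((E2) likewise).  In the VERTICAL case
the webs ARE the cylinder (offset `d ≡ 0`), so the v13 argument of `…Q4CurvedPeriodic.q4curved_translation_core` (K2-p2 g16) runs without any web/Huygens data:
`w := W′₂(−1, · + τ⃗) − W′₂(−1, ·)` is real-analytic, solves the slice law on the slope slab, and has ZERO CAUCHY DATA on the cylinder (values by (E2) and the period;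
gradients by (E1) and the `s`-free vertical derivative); either `μ(−1,·) ≡ 0` on `(−ρ, ρ)` — then `∂₂W′ₕ ≡ 0` on the open slab and
`…VerticalShearGerm.eq_zero_of_verticalShear_eq_zero_on_open` ends — or some height is non-characteristic (`μ(−1,z₀) ≠ 0`) — then CK across the cylinder
(`…CurvedSheetUniqueness.eqOn_zero_nhds_of_sheet` with `d ≡ 0`) gives a local horizontal period and `…HorizontalPeriod.false_of_local_horizontalPeriod_slab` ends.

* `slabLaw_of_tendsto_fderiv` — the slab law passes to pointwise limits of gradients;
* `apply_two_eq_of_tendstoLocallyUniformly` — moving-point transport of slice values;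
* `fderiv_line_e2` — `D θ (p + z•e₂) e₂ = deriv (z ↦ θ (p + z•e₂)) z`;
* ★★ `false_of_translation_limit_periodic` — LEMMA P.

WHAT THIS IS NOT: not a claim about Navier–Stokes regularity; a closable SUB-CASE of the research residue `…CurvedLimitsUniformlyCurved` (v18, ¬Y_T ∧ ¬X_H); the complement
(«no translation limit of the base curve is flat or translation-periodic» — the almost-periodic core) stays research; items 20428 / 19708 / 27893 OPEN (bears_on LADDER-NS N0).
-/

noncomputable section

set_option linter.dupNamespace false
set_option linter.style.longLine false

namespace Summit.NavierStokesRegularity.NavierStokesRegularity.Theorems.PoloidalWindowDoorLrcModEntireQ4CurvedTranslationPeriodic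

open Set Function Filter Topology Metric
open scoped RealInnerProductSpace InnerProductSpace ContDiff
open Literature.Analysis Literature.Analysis.FluidPDE Literature.Analysis.UnboundedOperators
open Summit.NavierStokesRegularity.NavierStokesRegularity.Theorems
open Summit.NavierStokesRegularity.NavierStokesRegularity.Theorems.PoloidalWindowDoorPoloidalWindowRigidityWindow
open Summit.NavierStokesRegularity.NavierStokesRegularity.Theorems.PoloidalWindowDoorLrcModEntireQ4CurvedTranslationFlat
open Summit.NavierStokesRegularity.NavierStokesRegularity.Theorems.PoloidalWindowDoorPoloidalWindowRigidityPoloidalExtremal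
open Summit.NavierStokesRegularity.NavierStokesRegularity.Theorems.PoloidalWindowDoorLrcModEntirePlanarCurveRigidity
open Summit.NavierStokesRegularity.NavierStokesRegularity.Theorems.PoloidalWindowDoorLrcModEntireSheetFlattenTools
open Summit.NavierStokesRegularity.NavierStokesRegularity.Theorems.PoloidalWindowDoorLrcModEntireRidgeGlobalBranchFrame
open Summit.NavierStokesRegularity.NavierStokesRegularity.Theorems.PoloidalWindowDoorLrcModEntireCurvedSheetUniqueness
open Summit.NavierStokesRegularity.NavierStokesRegularity.Theorems.PoloidalWindowDoorLrcModEntireHorizontalPeriod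
open Summit.NavierStokesRegularity.NavierStokesRegularity.Theorems.PoloidalWindowDoorLrcModEntireQ4CurvedPeriodic
open Summit.NavierStokesRegularity.NavierStokesRegularity.Theorems.PoloidalWindowDoorPoloidalWindowRigidityVerticalShearGerm
open Summit.NavierStokesRegularity.NavierStokesRegularity.Theorems.PoloidalWindowDoorPoloidalWindowRigidityTimeHeightShearLinearSlice
open Summit.NavierStokesRegularity.NavierStokesRegularity.Theorems.PoloidalWindowDoorPoloidalWindowRigidityConstantShearSlice
open Summit.NavierStokesRegularity.NavierStokesRegularity.Theorems.LocalSineTubeDoorProfileAlignedWindowRigidityAncient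

/-! ### A. Limit bookkeeping -/

/-- **The slab law `∂₂V_b = μ(t,x₂)∂_bV₂` passes to pointwise limits of gradients** (for the times `|t + 1| < ρ ≤ 1`, which are negative). -/
theorem slabLaw_of_tendsto_fderiv {Ws : ℕ → ℝ → EuclideanSpace ℝ (Fin 3) → EuclideanSpace ℝ (Fin 3)} {W : ℝ → EuclideanSpace ℝ (Fin 3) → EuclideanSpace ℝ (Fin 3)}
    {μ : ℝ → ℝ → ℝ} {ρ : ℝ} (hρ1 : ρ ≤ 1)
    (hconv : ∀ t < 0, ∀ x : EuclideanSpace ℝ (Fin 3), Tendsto (fun j => fderiv ℝ (Ws j t) x) atTop (𝓝 (fderiv ℝ (W t) x)))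
    (hslab : ∀ j : ℕ, ∀ t : ℝ, |t + 1| < ρ → ∀ x : EuclideanSpace ℝ (Fin 3), |x 2| < ρ → ∀ b : Fin 3, b ≠ 2 →
      fderiv ℝ (Ws j t) x (EuclideanSpace.single 2 1) b = μ t (x 2) * fderiv ℝ (Ws j t) x (EuclideanSpace.single b 1) 2) :
    ∀ t : ℝ, |t + 1| < ρ → ∀ x : EuclideanSpace ℝ (Fin 3), |x 2| < ρ → ∀ b : Fin 3, b ≠ 2 →
      fderiv ℝ (W t) x (EuclideanSpace.single 2 1) b = μ t (x 2) * fderiv ℝ (W t) x (EuclideanSpace.single b 1) 2 := by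
  intro t ht x hx b hb
  have ht0 : t < 0 := by linarith [(abs_lt.1 ht).2]
  have hev : ∀ (v : EuclideanSpace ℝ (Fin 3)) (i : Fin 3), Tendsto (fun j => fderiv ℝ (Ws j t) x v i) atTop (𝓝 (fderiv ℝ (W t) x v i)) := by
    intro v i
    have h1 : Tendsto (fun j => fderiv ℝ (Ws j t) x v) atTop (𝓝 (fderiv ℝ (W t) x v)) :=
      ((ContinuousLinearMap.apply ℝ (EuclideanSpace ℝ (Fin 3)) v).continuous.tendsto _).comp (hconv t ht0 x)
    exact ((EuclideanSpace.proj (𝕜 := ℝ) i).continuous.tendsto _).comp h1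
  have hL := hev (EuclideanSpace.single 2 1) b
  have hR : Tendsto (fun j => μ t (x 2) * fderiv ℝ (Ws j t) x (EuclideanSpace.single b 1) 2) atTop (𝓝 (μ t (x 2) * fderiv ℝ (W t) x (EuclideanSpace.single b 1) 2)) :=
    (hev (EuclideanSpace.single b 1) 2).const_mul _
  have heq : (fun j => fderiv ℝ (Ws j t) x (EuclideanSpace.single 2 1) b) = fun j => μ t (x 2) * fderiv ℝ (Ws j t) x (EuclideanSpace.single b 1) 2 :=
    funext fun j => hslab j t ht x hx b hb
  rw [heq] at hL
  exact tendsto_nhds_unique hL hR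

/-- **Moving-point transport of slice values**: locally uniform convergence of the slices + continuity of the limit + `xⱼ → x` + `(wⱼ xⱼ)₂ = c` ⇒ `(W x)₂ = c`. -/
theorem apply_two_eq_of_tendstoLocallyUniformly {ws : ℕ → EuclideanSpace ℝ (Fin 3) → EuclideanSpace ℝ (Fin 3)} {W : EuclideanSpace ℝ (Fin 3) → EuclideanSpace ℝ (Fin 3)}
    (hlu : TendstoLocallyUniformly ws W atTop) {x : EuclideanSpace ℝ (Fin 3)} (hWc : ContinuousAt W x)
    {xs : ℕ → EuclideanSpace ℝ (Fin 3)} (hxs : Tendsto xs atTop (𝓝 x)) {c : ℝ} (hc : ∀ j, ws j (xs j) 2 = c) : W x 2 = c := by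
  have h := hlu.tendsto_comp hWc hxs
  exact apply_two_eq_of_tendsto_const h hc

/-- The derivative of `θ` along the vertical line through `p`: `Dθ(p + z•e₂) e₂ = (z ↦ θ(p + z•e₂))′(z)`. -/
theorem fderiv_line_e2 {θ : EuclideanSpace ℝ (Fin 3) → ℝ} (hθ : Differentiable ℝ θ) (p : EuclideanSpace ℝ (Fin 3)) (z : ℝ) :
    fderiv ℝ θ (p + z • e2) e2 = deriv (fun z : ℝ => θ (p + z • e2)) z := by
  have hl : HasDerivAt (fun z : ℝ => p + z • e2) e2 z := by
    simpa using ((hasDerivAt_id z).smul_const e2).const_add p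
  exact ((hθ (p + z • e2)).hasFDerivAt.comp_hasDerivAt z hl).deriv.symm

/-! ### B. LEMMA P -/

/-- ★★ **LEMMA P — THE PERIODIC-TRANSLATION-LIMIT KILL.**  Hypotheses: the route's class quintuple for `U`, the hot value `U₂(−1,0) ≠ 0`, the slab slope law
`∂₂U_b = μ(t,x₂)∂_bU₂` on `|t+1| < ρ`, `|x₂| < ρ` (`0 < ρ ≤ 1`, `μ(−1,·)` continuous), a planar base curve `Γ` on the hot level carrying (E1) (horizontal
criticality of `U₂(−1,·)` on the whole cylinder `Γ × ℝ`) and (E2) (`s`-free values there), base parameters `a n` with `Γ(a n + s) − Γ(a n) → Γ′(s)` pointwise, `Γ′`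
a `C²` unit-speed curve with a non-zero translation period `Γ′(s + L) = Γ′(s) + τ⃗`.  Conclusion: `False`.  See the module docstring for the proof. -/
theorem false_of_translation_limit_periodic {C : ℝ} {U : ℝ → EuclideanSpace ℝ (Fin 3) → EuclideanSpace ℝ (Fin 3)}
    (hrate : HasTypeITimeDecay C U) (hcont : ContinuousOn (uncurry U) (Iio (0 : ℝ) ×ˢ univ))
    (hmild : ∀ s t : ℝ, s < t → t < 0 → ∀ x, U t x = heatExtension (U s) (t - s) x - oseenDuhamel 1 s U U t x)
    (hdiv : ∀ t < 0, VectorCalculus.IsDivFree (U t))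
    (hpol : ∀ s < 0, ∀ q, ⟪curl (U s) q, EuclideanSpace.single 2 1⟫_ℝ = 0)
    (hne : U (-1) 0 2 ≠ 0)
    {μ : ℝ → ℝ → ℝ} {ρ : ℝ} (hρ : 0 < ρ) (hρ1 : ρ ≤ 1) (hμc : Continuous (μ (-1)))
    (hslabU : ∀ t : ℝ, |t + 1| < ρ → ∀ x : EuclideanSpace ℝ (Fin 3), |x 2| < ρ → ∀ b : Fin 3, b ≠ 2 →
      fderiv ℝ (U t) x (EuclideanSpace.single 2 1) b = μ t (x 2) * fderiv ℝ (U t) x (EuclideanSpace.single b 1) 2)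
    {Γ : ℝ → EuclideanSpace ℝ (Fin 3)} (hΓ2 : ∀ s, Γ s 2 = 0) (hhot : ∀ s, U (-1) (Γ s) 2 = U (-1) 0 2)
    (hcurt : ∀ s z : ℝ, ∀ w : EuclideanSpace ℝ (Fin 3), w 2 = 0 →
      fderiv ℝ (fun y => U (-1) y 2) (Γ s + z • EuclideanSpace.single 2 (1 : ℝ)) w = 0)
    (hvals : ∀ s z : ℝ, U (-1) (Γ s + z • EuclideanSpace.single 2 (1 : ℝ)) 2 = U (-1) (Γ 0 + z • EuclideanSpace.single 2 (1 : ℝ)) 2)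
    {a : ℕ → ℝ} {Γ' : ℝ → EuclideanSpace ℝ (Fin 3)} (hlim : ∀ s : ℝ, Tendsto (fun n => Γ (a n + s) - Γ (a n)) atTop (𝓝 (Γ' s)))
    (hΓ' : ContDiff ℝ 2 Γ') (hunit' : ∀ s, ‖deriv Γ' s‖ = 1)
    {τ : EuclideanSpace ℝ (Fin 3)} {L : ℝ} (hτ : τ ≠ 0) (hper : ∀ s, Γ' (s + L) = Γ' s + τ) : False := by
  have hs1 : (-1 : ℝ) < 0 := by norm_num
  have he2 : (EuclideanSpace.single 2 (1 : ℝ) : EuclideanSpace ℝ (Fin 3)) = e2 := rfl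
  -- the limit curve is planar and the period is horizontal
  have hΓ'2 : ∀ s, Γ' s 2 = 0 := fun s =>
    PoloidalWindowDoorLrcModEntireQ4CurvedTranslationFlat.apply_two_eq_zero_of_tendsto (hlim s) fun n => by simp [hΓ2]
  have hτ2 : τ 2 = 0 := by
    have h := hper 0
    rw [zero_add] at h
    have h2 : τ = Γ' L - Γ' 0 := by rw [h]; abel
    rw [h2]; simp [hΓ'2]
  -- H1: the translated sequence in the class; H3: extraction
  have hA : IsTypeIAncientMild C U := isTypeIAncientMild_of_class hrate hcont hmild hdiv
  set w : ℕ → ℝ → EuclideanSpace ℝ (Fin 3) → EuclideanSpace ℝ (Fin 3) := fun n t y => U t (y + Γ (a n)) with hw_def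
  have hw : ∀ n, IsTypeIAncientMild C (w n) := fun n => hA.comp_add_right (Γ (a n))
  obtain ⟨φ, hφ, W', hW', hpt, hfd, hlu, hfdlu⟩ := exists_tendsto_of_isTypeIAncientMild_seq C hw
  have hW'rate := hW'.hasTypeITimeDecay
  have hW'cont := hW'.continuousOn_uncurry
  have hW'mild : ∀ s t : ℝ, s < t → t < 0 → ∀ x, W' t x = heatExtension (W' s) (t - s) x - oseenDuhamel 1 s W' W' t x :=
    fun s t hst ht x => hW'.mild_eq_heatExtension hst ht x
  have hW'div : ∀ t < 0, VectorCalculus.IsDivFree (W' t) := fun t ht => hW'.isDivFree ht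
  -- H4: the hot value at the origin
  have hval : W' (-1) 0 2 = U (-1) 0 2 := by
    refine apply_two_eq_of_tendsto_const (hpt (-1) hs1 0) fun j => ?_
    show U (-1) (0 + Γ (a (φ j))) 2 = U (-1) 0 2
    rw [zero_add]; exact hhot _
  have hneW : W' (-1) 0 2 ≠ 0 := by rw [hval]; exact hne
  -- H5: poloidality and the slab law pass to the limit
  have hpolW : ∀ s < 0, ∀ q, ⟪curl (W' s) q, EuclideanSpace.single 2 1⟫_ℝ = 0 := by
    intro s hs q
    refine poloidal_of_tendsto (V := fun j => w (φ j) s) (hfd s hs q) fun j => ?_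
    show ⟪curl (fun y => U s (y + Γ (a (φ j)))) q, EuclideanSpace.single 2 1⟫_ℝ = 0
    rw [PoloidalWindowDoorLrcModEntireWeightSourceTranslate.curl_translate]
    exact hpol s hs _
  have hslabW := slabLaw_of_tendsto_fderiv (Ws := fun j => w (φ j)) (W := W') hρ1 hfd
    fun j => PoloidalWindowDoorLrcModEntireWeightSourceTranslate.slabLaw_translate hslabU (a := Γ (a (φ j))) (hΓ2 _)
  -- H6: (E1) and (E2) on the limit cylinder `Γ′ × ℝ`
  have hW'd : Differentiable ℝ (W' (-1)) := (hW'.contDiff_slice hs1).differentiable (by simp)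
  have hW'c : Continuous (fderiv ℝ (W' (-1))) := (hW'.contDiff_slice hs1).continuous_fderiv (by simp)
  have hxs : ∀ s z : ℝ, Tendsto (fun j => (Γ (a (φ j) + s) - Γ (a (φ j))) + z • EuclideanSpace.single 2 (1 : ℝ)) atTop
      (𝓝 (Γ' s + z • EuclideanSpace.single 2 (1 : ℝ))) := fun s z =>
    ((hlim s).comp hφ.tendsto_atTop).add tendsto_const_nhds
  have hshift : ∀ (j : ℕ) (s z : ℝ), (Γ (a (φ j) + s) - Γ (a (φ j))) + z • EuclideanSpace.single 2 (1 : ℝ) + Γ (a (φ j)) =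
      Γ (a (φ j) + s) + z • EuclideanSpace.single 2 (1 : ℝ) := fun j s z => by abel
  have hcurtW : ∀ s z : ℝ, ∀ v : EuclideanSpace ℝ (Fin 3), v 2 = 0 →
      fderiv ℝ (fun y => W' (-1) y 2) (Γ' s + z • EuclideanSpace.single 2 (1 : ℝ)) v = 0 := by
    intro s z v hv
    refine fderiv_apply_two_eq_zero_of_tendstoLocallyUniformly (ws := fun j => w (φ j) (-1)) (hfdlu (-1) hs1) hW'c.continuousAt (hW'd _) (hxs s z)
      (fun j => ((hw (φ j)).contDiff_slice hs1).differentiable (by simp) _) fun j => ?_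
    have hcomp : fderiv ℝ (fun y : EuclideanSpace ℝ (Fin 3) => U (-1) (y + Γ (a (φ j))) 2) ((Γ (a (φ j) + s) - Γ (a (φ j))) + z • EuclideanSpace.single 2 (1 : ℝ)) =
        fderiv ℝ (fun y' : EuclideanSpace ℝ (Fin 3) => U (-1) y' 2) ((Γ (a (φ j) + s) - Γ (a (φ j))) + z • EuclideanSpace.single 2 (1 : ℝ) + Γ (a (φ j))) :=
      fderiv_comp_add_right (f := fun y' : EuclideanSpace ℝ (Fin 3) => U (-1) y' 2) (Γ (a (φ j)))
    show fderiv ℝ (fun y => U (-1) (y + Γ (a (φ j))) 2) ((Γ (a (φ j) + s) - Γ (a (φ j))) + z • EuclideanSpace.single 2 (1 : ℝ)) v = 0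
    rw [hcomp, hshift]
    exact hcurt _ _ v hv
  set Rt : ℝ → ℝ := fun z => U (-1) (Γ 0 + z • EuclideanSpace.single 2 (1 : ℝ)) 2 with hRt_def
  have hvalsW : ∀ s z : ℝ, W' (-1) (Γ' s + z • EuclideanSpace.single 2 (1 : ℝ)) 2 = Rt z := by
    intro s z
    refine apply_two_eq_of_tendstoLocallyUniformly (ws := fun j => w (φ j) (-1)) (hlu (-1) hs1) (hW'.continuous_slice hs1).continuousAt (hxs s z) fun j => ?_
    show U (-1) ((Γ (a (φ j) + s) - Γ (a (φ j))) + z • EuclideanSpace.single 2 (1 : ℝ) + Γ (a (φ j))) 2 = Rt z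
    rw [hshift]
    exact hvals _ _
  -- H7: the slice `θ := W′₂(−1,·)`, analytic, and its slice law on the slope slab
  have hWan : AnalyticOnNhd ℝ (W' (-1)) univ := analyticOnNhd_slice hW'cont (bdd_of_hasTypeITimeDecay hW'rate) hW'mild hs1
  have hW2 : ContDiff ℝ 2 (W' (-1)) := hWan.contDiff
  have hθan : AnalyticOnNhd ℝ (fun y => W' (-1) y 2) univ := fun y _ =>
    ((EuclideanSpace.proj (𝕜 := ℝ) (2 : Fin 3)).analyticAt _).comp (hWan y (mem_univ _))
  have hθ2 : ContDiff ℝ 2 (fun y => W' (-1) y 2) := hθan.contDiff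
  have hθd : Differentiable ℝ (fun y => W' (-1) y 2) := hθ2.differentiable (by norm_num)
  have hplane : ∀ z : ℝ, |z| < ρ → ∀ y : EuclideanSpace ℝ (Fin 3), y 2 = z → ∀ b : Fin 3, b ≠ 2 →
      fderiv ℝ (W' (-1)) y (EuclideanSpace.single 2 (1 : ℝ)) b = μ (-1) z * fderiv ℝ (W' (-1)) y (EuclideanSpace.single b (1 : ℝ)) 2 := by
    intro z hz y hy b hb
    have h := hslabW (-1) (by simpa using hρ) y (by rw [hy]; exact hz) b hb
    rw [hy] at h; exact h
  have hlawθ : ∀ x : EuclideanSpace ℝ (Fin 3), |x 2| < ρ →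
      fderiv ℝ (fun y => fderiv ℝ (fun y' => W' (-1) y' 2) y (EuclideanSpace.single 2 (1 : ℝ))) x (EuclideanSpace.single 2 (1 : ℝ)) =
        -μ (-1) (x 2) * (fderiv ℝ (fun y => fderiv ℝ (fun y' => W' (-1) y' 2) y (EuclideanSpace.single 0 (1 : ℝ))) x (EuclideanSpace.single 0 (1 : ℝ)) +
          fderiv ℝ (fun y => fderiv ℝ (fun y' => W' (-1) y' 2) y (EuclideanSpace.single 1 (1 : ℝ))) x (EuclideanSpace.single 1 (1 : ℝ))) :=
    fun x hx => plane_wave_identity hW2 (fun y => div_coord (hW'div (-1) hs1) y) (hplane (x 2) hx) rfl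
  -- DICHOTOMY on the slope at time `−1`
  by_cases hAμ : ∃ z₀ ∈ Ioo (-ρ) ρ, μ (-1) z₀ ≠ 0
  · /- CASE (A): a non-characteristic height — CK across the cylinder, then the periodic Liouville endgame. -/
    obtain ⟨z₀, hz₀, hμz₀⟩ := hAμ
    set J : Set ℝ := Ioo (-ρ) ρ ∩ (μ (-1)) ⁻¹' ({0}ᶜ) with hJ_def
    have hJo : IsOpen J := hμc.continuousOn.isOpen_inter_preimage isOpen_Ioo isOpen_compl_singleton
    have hz₀J : z₀ ∈ J := ⟨hz₀, hμz₀⟩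
    have hJsub : ∀ z ∈ J, |z| < ρ := fun z hz => abs_lt.2 ⟨hz.1.1, hz.1.2⟩
    -- the difference `w = θ(· + τ⃗) − θ`
    set wd : EuclideanSpace ℝ (Fin 3) → ℝ := fun y => W' (-1) (y + τ) 2 - W' (-1) y 2 with hwd_def
    have hwdan : AnalyticOnNhd ℝ wd univ := by
      intro x _
      have hsh : AnalyticAt ℝ (fun y : EuclideanSpace ℝ (Fin 3) => y + τ) x := analyticAt_id.add analyticAt_const
      exact ((hθan (x + τ) (mem_univ _)).comp_of_eq hsh rfl).sub (hθan x (mem_univ _))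
    have hlaww : ∀ x : EuclideanSpace ℝ (Fin 3), x 2 ∈ J →
        fderiv ℝ (fun y => fderiv ℝ wd y (EuclideanSpace.single 2 (1 : ℝ))) x (EuclideanSpace.single 2 (1 : ℝ)) =
          -μ (-1) (x 2) * (fderiv ℝ (fun y => fderiv ℝ wd y (EuclideanSpace.single 0 (1 : ℝ))) x (EuclideanSpace.single 0 (1 : ℝ)) +
            fderiv ℝ (fun y => fderiv ℝ wd y (EuclideanSpace.single 1 (1 : ℝ))) x (EuclideanSpace.single 1 (1 : ℝ))) := by
      intro x hx
      have hxρ : |x 2| < ρ := hJsub _ hx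
      have hxτ : (x + τ) 2 = x 2 := by simp [hτ2]
      have h1 := hlawθ x hxρ
      have h2 := hlawθ (x + τ) (by rw [hxτ]; exact hxρ)
      rw [hxτ] at h2
      rw [hwd_def, nested_translate_sub hθ2, nested_translate_sub hθ2, nested_translate_sub hθ2, h1, h2]
      ring
    -- Frenet law of the limit curve
    have hk : ∀ s, deriv (deriv Γ') s = (fun s => ⟪deriv (deriv Γ') s, rotJ (deriv Γ' s)⟫_ℝ) s • rotJ (deriv Γ' s) := fun s =>
      deriv_deriv_eq_curvature_smul hΓ' hΓ'2 hunit' s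
    -- the cylinder as the sheet with offset `d ≡ 0`
    have hpt0 : ∀ s z : ℝ, Γ' s + (fun _ : ℝ => (0 : ℝ)) z • rotJ (deriv Γ' s) + z • e2 = Γ' s + z • EuclideanSpace.single 2 (1 : ℝ) := by
      intro s z; simp only [zero_smul, add_zero, he2]
    have hperz : ∀ s z : ℝ, Γ' s + z • EuclideanSpace.single 2 (1 : ℝ) + τ = Γ' (s + L) + z • EuclideanSpace.single 2 (1 : ℝ) := by
      intro s z; rw [hper]; abel
    -- zero Cauchy data: values
    have h0 : ∀ s : ℝ, ∀ z ∈ J, wd (Γ' s + (fun _ : ℝ => (0 : ℝ)) z • rotJ (deriv Γ' s) + z • e2) = 0 := by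
      intro s z _
      rw [hpt0]
      show W' (-1) (Γ' s + z • EuclideanSpace.single 2 (1 : ℝ) + τ) 2 - W' (-1) (Γ' s + z • EuclideanSpace.single 2 (1 : ℝ)) 2 = 0
      rw [hperz, hvalsW, hvalsW, sub_self]
    -- the vertical derivative on the cylinder is `s`-free
    have hvert : ∀ s z : ℝ, fderiv ℝ (fun y => W' (-1) y 2) (Γ' s + z • EuclideanSpace.single 2 (1 : ℝ)) (EuclideanSpace.single 2 (1 : ℝ)) = deriv Rt z := by
      intro s z
      rw [he2, fderiv_line_e2 hθd (Γ' s) z]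
      congr 1
      funext z'
      rw [← he2]
      exact hvalsW s z'
    -- zero Cauchy data: gradients
    have h1 : ∀ s : ℝ, ∀ z ∈ J, fderiv ℝ wd (Γ' s + (fun _ : ℝ => (0 : ℝ)) z • rotJ (deriv Γ' s) + z • e2) = 0 := by
      intro s z _
      rw [hpt0]
      set P : EuclideanSpace ℝ (Fin 3) := Γ' s + z • EuclideanSpace.single 2 (1 : ℝ) with hP
      have hτd' : DifferentiableAt ℝ (fun y => W' (-1) (y + τ) 2) P := (hθd _).comp P (differentiableAt_id.add_const τ)
      have hsh : fderiv ℝ (fun y => W' (-1) (y + τ) 2) P = fderiv ℝ (fun y => W' (-1) y 2) (P + τ) :=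
        fderiv_comp_add_right (f := fun y => W' (-1) y 2) τ
      have hfw : fderiv ℝ wd P = fderiv ℝ (fun y => W' (-1) y 2) (P + τ) - fderiv ℝ (fun y => W' (-1) y 2) P := by
        rw [hwd_def, fderiv_fun_sub hτd' (hθd P), hsh]
      rw [hfw, sub_eq_zero, hP, hperz]
      refine clm_eq_of_apply_single fun i => ?_
      fin_cases i
      · rw [hcurtW (s + L) z _ (by simp), hcurtW s z _ (by simp)]
      · rw [hcurtW (s + L) z _ (by simp), hcurtW s z _ (by simp)]
      · simp only [Fin.reduceFinMk]
        rw [hvert (s + L) z, hvert s z]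
    -- CK across the non-characteristic cylinder piece
    have hdJ : ContDiffOn ℝ ∞ (fun _ : ℝ => (0 : ℝ)) J := contDiffOn_const
    have hJfac : ∀ s : ℝ, ∀ z ∈ J, 1 - (fun s => ⟪deriv (deriv Γ') s, rotJ (deriv Γ' s)⟫_ℝ) s * (fun _ : ℝ => (0 : ℝ)) z ≠ 0 := by
      intro s z _; simp
    have hQ : ∀ z ∈ J, deriv (fun _ : ℝ => (0 : ℝ)) z ^ 2 + μ (-1) z ≠ 0 := by
      intro z hz
      simpa using hz.2
    have hev := eqOn_zero_nhds_of_sheet hwdan hJo hdJ hΓ' hΓ'2 hunit' hk hJfac (μ := μ (-1)) hlaww h0 h1 hQ 0 hz₀J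
    obtain ⟨V, hVsub, hVo, hPV⟩ := _root_.mem_nhds_iff.1 hev
    exact false_of_local_horizontalPeriod_slab hW'rate hW'cont hW'mild hW'div hpolW hneW hρ hslabW hτ2 hτ hVo ⟨_, hPV⟩
      fun x hx => by have h := hVsub hx; simpa [hwd_def, sub_eq_zero] using h
  · /- CASE (B): `μ(−1,·) ≡ 0` on `(−ρ, ρ)` — the horizontal velocity has no vertical shear on the open slab. -/
    push Not at hAμ
    have hopen : IsOpen {y : EuclideanSpace ℝ (Fin 3) | |y 2| < ρ} := isOpen_slab ρ
    have hne0 : ({y : EuclideanSpace ℝ (Fin 3) | |y 2| < ρ}).Nonempty := ⟨0, by simpa using hρ⟩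
    have hshear : ∀ y ∈ {y : EuclideanSpace ℝ (Fin 3) | |y 2| < ρ},
        fderiv ℝ (W' (-1)) y (EuclideanSpace.single 2 1) 0 = 0 ∧ fderiv ℝ (W' (-1)) y (EuclideanSpace.single 2 1) 1 = 0 := by
      intro y hy
      have hyρ : |y 2| < ρ := hy
      have hμ0 : μ (-1) (y 2) = 0 := hAμ (y 2) ⟨by linarith [(abs_lt.1 hyρ).1], (abs_lt.1 hyρ).2⟩
      refine ⟨?_, ?_⟩
      · have h := hslabW (-1) (by simpa using hρ) y hyρ 0 (by decide)
        rw [hμ0, zero_mul] at h; exact h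
      · have h := hslabW (-1) (by simpa using hρ) y hyρ 1 (by decide)
        rw [hμ0, zero_mul] at h; exact h
    have hzero := eq_zero_of_verticalShear_eq_zero_on_open hW'rate hW'cont hW'mild hW'div hs1 hopen hne0 hshear
    exact hneW (by rw [hzero (-1) hs1 0]; rfl)

end Summit.NavierStokesRegularity.NavierStokesRegularity.Theorems.PoloidalWindowDoorLrcModEntireQ4CurvedTranslationPeriodic

end
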